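import Mathlib
import Summits.NavierStokesRegularity.NavierStokesRegularity.Theorems.FrozenSignCascadeEnvelopeBoundWeightedDeriv
import Summits.NavierStokesRegularity.NavierStokesRegularity.Theorems.FrozenSignCascadeEnvelopeBoundStubEnergyCancellation
import HarnessLib

/-!
# Route FrozenSignCascade · crux `EnvelopeBound` (stmt-NavierStokesRegularity-1549): the Fourier-side energy
  identity with dissipation, and the a-priori horizon of the far-from-Leray regime

Support file for the crux item stmt-NavierStokesRegularity-1549 (`EnvelopeBound`, route `FrozenSignCascade`,
line `registered`, reshape r3, lead c3); lands `--supports` that item. From the landed slice-level cancellation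
`Leray.stub_energyCancellation` (`Re ∫∑ₗ conj(vₗ)N(v,v)ₗ = 0` for continuous, decaying, divergence-free,
conjugation-symmetric `v`) and the calculus layer (`Leray.hasDerivAt_energy`, `Leray.continuous_energy`,
`Leray.continuous_enstrophy`):

* `energyDissip`: **the energy identity with dissipation** of Fourier-side mild solutions on `ℝ³`,
  `∫∑ₗ‖V(t)ₗ‖² + 2c ∫ₛᵗ(∫‖ξ‖²∑ₗ‖V(r)ₗ‖²)dr = ∫∑ₗ‖V(s)ₗ‖²` for `t₀ ≤ s ≤ t ≤ t₁` — the Plancherel form of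
  `‖u(t)‖² + 2ν∫ₛᵗ‖∇u‖² = ‖u(s)‖²`. Unlike every earlier estimate of the line this is an IDENTITY of the true
  equation: it uses `divFree` and `conjSymm` and fails for the cheap (magnitude) equation;
* `far_horizon`: if the enstrophy stays `≥ ω > 0` on `[0,t]` then `t ≤ E(0)/(2cω)`.
* `energyDissip_fin3`: the registered explicit form.

References: J. Leray, Acta Math. 63 (1934) §22; P. G. Lemarié-Rieusset (2016), Thm. 7.2, Prop. 12.1.
-/

noncomputable section

set_option linter.dupNamespace false -- nested layout Summit.<S>.<Sub>, Sub = S (D-0017)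

open Set MeasureTheory Filter Topology Real
open Literature.Analysis.FluidPDE Literature.Analysis.FluidPDE.FourierNS
open Summit.NavierStokesRegularity.NavierStokesRegularity.Theorems.EnvelopeBound

namespace Summit.NavierStokesRegularity.NavierStokesRegularity.Theorems.EnvelopeBound.Leray

section Energy

variable {c t₀ t₁ : ℝ} {K₀ : ℕ} {V : ℝ → EuclideanSpace ℝ (Fin 3) → Fin 3 → ℂ}

/-- **The energy identity with dissipation** (from `stub_energyCancellation`): for `V` mild on `[t₀,t₁]` and
`t₀ ≤ s ≤ t ≤ t₁`, `E(t) + 2c ∫ₛᵗ Ens = E(s)`. Proof: at interior times `E' = -2c·Ens − 2∫∑Re(conj Vₗ Nₗ)`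
(`Leray.hasDerivAt_energy`, landed) and the pairing vanishes (stub 3 on the slice); `E` is continuous
(`Leray.continuous_energy`), `Ens` is continuous, and the fundamental theorem of calculus applies on `[s,t]`. -/
theorem energyDissip (h : IsFourierMild c K₀ t₀ t₁ V) {s t : ℝ} (hs : t₀ ≤ s) (hst : s ≤ t) (ht : t ≤ t₁) :
    (∫ ξ, ∑ l, ‖V t ξ l‖ ^ 2) + 2 * c * (∫ r in s..t, ∫ ξ, ‖ξ‖ ^ 2 * ∑ l, ‖V r ξ l‖ ^ 2) =
      ∫ ξ, ∑ l, ‖V s ξ l‖ ^ 2 := by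
  have hderiv : ∀ r ∈ Ioo s t, HasDerivAt (fun r => ∫ ξ, ∑ l, ‖V r ξ l‖ ^ 2)
      (-(2 * c) * ∫ ξ, ‖ξ‖ ^ 2 * ∑ l, ‖V r ξ l‖ ^ 2) r := by
    intro r hr
    have hr' : r ∈ Ioo t₀ t₁ := ⟨lt_of_le_of_lt hs hr.1, lt_of_lt_of_le hr.2 ht⟩
    have hd := (Leray.hasDerivAt_energy h hr').2
    have hcanc := stub_energyCancellation (V r) (h.continuous_slice r)
      (fun K => (h.decay K).imp fun A hA => hA r) (h.divFree r) (h.conjSymm r)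
    rw [hcanc, mul_zero, sub_zero] at hd
    exact hd
  have hcont : ContinuousOn (fun r => ∫ ξ, ∑ l, ‖V r ξ l‖ ^ 2) (Icc s t) :=
    (Leray.continuous_energy h).continuousOn
  have hint : IntervalIntegrable (fun r => -(2 * c) * ∫ ξ, ‖ξ‖ ^ 2 * ∑ l, ‖V r ξ l‖ ^ 2) volume s t :=
    (continuous_const.mul (Leray.continuous_enstrophy h)).intervalIntegrable _ _
  have key := intervalIntegral.integral_eq_sub_of_hasDerivAt_of_le hst hcont hderiv hint
  rw [intervalIntegral.integral_const_mul] at key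
  linarith

/-- **Finite dissipation**: along a mild `V` on `[t₀,t₁]`, `2c ∫ₛᵗ Ens ≤ E(s)` for `t₀ ≤ s ≤ t ≤ t₁` (the energy
identity and `E(t) ≥ 0`) — the Fourier form of `2ν∫‖∇u‖² ≤ ‖u(s)‖²`. -/
theorem dissipation_le (h : IsFourierMild c K₀ t₀ t₁ V) {s t : ℝ} (hs : t₀ ≤ s) (hst : s ≤ t) (ht : t ≤ t₁) :
    2 * c * (∫ r in s..t, ∫ ξ, ‖ξ‖ ^ 2 * ∑ l, ‖V r ξ l‖ ^ 2) ≤ ∫ ξ, ∑ l, ‖V s ξ l‖ ^ 2 := by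
  have hid := energyDissip h hs hst ht
  have hEt : 0 ≤ ∫ ξ, ∑ l, ‖V t ξ l‖ ^ 2 :=
    integral_nonneg fun ξ => Finset.sum_nonneg fun l _ => sq_nonneg _
  linarith

/-- **The a-priori horizon of the far regime.** Along a mild `V` on `[0,T]`, if the enstrophy stays `≥ ω > 0`
on `[0,t]` then `t ≤ E(0)/(2cω)`: `2cωt ≤ 2c∫₀ᵗ Ens = E(0) − E(t) ≤ E(0)`. -/
theorem far_horizon (h : IsFourierMild c K₀ 0 t₁ V) {ω : ℝ} (hω : 0 < ω) {t : ℝ} (ht : t ∈ Icc 0 t₁)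
    (hfar : ∀ r ∈ Icc 0 t, ω ≤ ∫ ξ, ‖ξ‖ ^ 2 * ∑ l, ‖V r ξ l‖ ^ 2) :
    t ≤ (∫ ξ, ∑ l, ‖V 0 ξ l‖ ^ 2) / (2 * c * ω) := by
  have hc : 0 < c := h.hc
  have hid := energyDissip h le_rfl ht.1 ht.2
  have hEt : 0 ≤ ∫ ξ, ∑ l, ‖V t ξ l‖ ^ 2 :=
    integral_nonneg fun ξ => Finset.sum_nonneg fun l _ => sq_nonneg _
  have hlow : ω * t ≤ ∫ r in (0:ℝ)..t, ∫ ξ, ‖ξ‖ ^ 2 * ∑ l, ‖V r ξ l‖ ^ 2 := by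
    have h1 : ∫ r in (0:ℝ)..t, ω = ω * t := by simp [mul_comm]
    rw [← h1]
    exact intervalIntegral.integral_mono_on ht.1 (by simp)
      ((Leray.continuous_enstrophy h).intervalIntegrable _ _) fun r hr => hfar r hr
  rw [le_div_iff₀ (by positivity)]
  nlinarith [mul_le_mul_of_nonneg_left hlow (by positivity : (0:ℝ) ≤ 2 * c)]

end Energy

/-- **The energy identity with dissipation on `ℝ³` (registered support statement, all binders explicit).** -/
theorem energyDissip_fin3 :
    ∀ (c : ℝ) (K₀ : ℕ) (t₀ t₁ : ℝ) (V : ℝ → EuclideanSpace ℝ (Fin 3) → Fin 3 → ℂ),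
      Literature.Analysis.FluidPDE.FourierNS.IsFourierMild c K₀ t₀ t₁ V →
      ∀ s t : ℝ, t₀ ≤ s → s ≤ t → t ≤ t₁ →
        (∫ ξ, ∑ l, ‖V t ξ l‖ ^ 2) + 2 * c * (∫ r in s..t, ∫ ξ, ‖ξ‖ ^ 2 * ∑ l, ‖V r ξ l‖ ^ 2) =
          ∫ ξ, ∑ l, ‖V s ξ l‖ ^ 2 :=
  fun _ _ _ _ _ h _ _ hs hst ht => energyDissip h hs hst ht

end Summit.NavierStokesRegularity.NavierStokesRegularity.Theorems.EnvelopeBound.Leray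

end
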